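import Literature.MathematicalPhysics.QuantumFieldTheory.Borinsky2020.KirchhoffPermutahedron
import Mathlib.Combinatorics.Matroid.Minor.Contract
import HarnessLib

/-!
# UV factorisation of the Kirchhoff polynomial: `Ψ_G = Ψ_γ Ψ_{G/γ} + R^Ψ_{γ,G}` with `deg_γ R > h_γ` (Brown 2017, Lemma 2.1 / Prop. 2.2; Schultka 2018, Prop. 4.11; the factorisation law behind Borinsky 2020 Thm 32 and the K-operation) — PROVED, in the tree's cycle-matroid vocabulary

independent recomputation; certified where stated, statistical where stated; no new-physics claim.

CITATION HEADER (venture `QEDPrecision`, cell `pub-qed`, track TROPICAL, LIT seat `pub-qed-trop-lit` gen 29; VALUE-FREE: an identity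
between polynomials attached to an arbitrary connected edge list and an arbitrary edge subset; nothing per word). Companion of
`Borinsky2020/KirchhoffPermutahedron.lean` (same seat: `NP_{Ψ_G} = 𝒢_ℓ`, whose support function gives `deg_γ` below) and of
`MatrixTreeTheorem.lean` (`Ψ_E = Σ_T Π_{e∉T} X_e`), `CycleMatroidSpanningTrees.lean` (bases = spanning trees), `HeppSectorDominance.lean`
(`|T ∩ γ| ≤ rk γ`). Borinsky's proof of Theorem 32 says "The form of the boolean functions z_Ψ and z_Φ follows directly from the
factorization laws [Brown, Proposition 2.2, Proposition 2.4, Theorem 2.7]"; the UV factorisation of `Ψ` is also the algebra under the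
forest formula's `K`-operation (the track's chart K, `tropical/lit/SOURCES.md` A12: "K-operation = face value on each UV face"). This file
types the `Ψ`-law, Proposition 2.2's first line, with Lemma 2.1's bijection, in the language the tree already has: the quotient graph
`G/γ` enters through its cycle matroid `M(G)/γ` (Oxley: `M(G/T) = M(G)/T`), the components `γ_i` through the bases of `γ`.

SOURCES, VERBATIM. [Brown2017] F. Brown, "Feynman amplitudes, coaction principle, and cosmic Galois group", Commun. Number Theory
Phys. 11 (2017) 453–556 = arXiv:1512.06409v3 (corpus `paper:arxiv-1512.06409`, tex chunks p0012:L1–L66), §2.1 "UV factorizations":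
"Let G be a connected Feynman graph, and let γ ⊂ E_G be an edge-subgraph with connected components γ_1,…,γ_n. **Lemma 2.1.** The map
T ↦ (T/(T∩γ), T∩γ_1, …, T∩γ_n) is a bijection from: {Spanning k-trees T such that γ_i ∩ T is connected for all i=1,…,n} to {Spanning
k-trees in G/γ} × Π_{i=1}^n {Spanning trees in γ_i}" · "The following factorisation formulae are essentially well-known [Angles].
**Proposition 2.2.** Let G be connected, γ ⊂ E_G as above. Then Ψ_G = Ψ_γ Ψ_{G/γ} + R^Ψ_{γ,G}, Φ_G(q) = Ψ_γ Φ_{G/γ}(q) +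
R^{Φ,UV}_{γ,G}(q) where the degree of R^Ψ_{γ,G} and R^{Φ,UV}_{γ,G}(q) in the variables α_e, e ∈ E_γ is strictly greater than deg Ψ_γ =
deg Π_{i=1}^n Ψ_{γ_i} = h_γ." · proof: "the set of monomials in Ψ_G … are in one-to-one correspondence with the set of spanning
k-trees T ⊂ G. The latter can be partitioned into two subsets: those for which T ∩ γ_i is connected for all i, and those for which T ∩ γ_i
is not connected for some i. The former class is in one-to-one correspondence, by lemma 2.1, with the monomials in Ψ_{γ_1}…Ψ_{γ_n} ×
Ψ_{G/γ} … Thus the degree of the monomial Π_{e∉T} α_e in the variables α_e for e ∈ E_γ is … h_γ + Σ_{i=1}^n (κ_{T∩γ_i} − 1). This is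
strictly greater than h_γ whenever some T ∩ γ_i is not connected." [Schultka2018] K. Schultka, arXiv:1806.01086 (HOME
`data/lit/sources/.cache/1806.01086/toricfeynman.tex`), **Proposition 4.11** [citing Brown] (l.2236–2255): "(1) There are polynomials
R^ψ_{G|γ}, R^φ_{G|γ} and R^Φ_{G|γ}, such that ψ_G = ψ_{G|γ} + R^ψ_{G|γ} … The degree deg_γ(R^·_{G|γ}) of the rest terms in the
variables (α_e)_{e∈γ} satisfies deg_γ(R^ψ_{G|γ}) > deg_γ(ψ_{G|γ}) = h¹_γ …" "(2) The polynomial R^ψ_{G|γ} vanishes if and only if, for any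
spanning tree T ⊂ G, the graphs γ_i ∩ T are connected." and its proof sketch (l.2283–2296): "consider the subset 𝒯^k_γ of spanning
k-trees of G, such that the intersections T ∪ γ_i are connected … its elements are exactly those spanning k-trees, such that Σ_i |T ∩ γ_i|
is maximal. The corresponding monomial α^S for S = E_G∖T is then minimal in the variables (α_e)_{e∈γ}. Decomposing the sum over k-trees
into a sum over 𝒯^k_γ and its complement gives the decompositions ψ_G = ψ_γ ψ_{G/γ} + R^ψ_{G|γ}"; §4 after Cor. 4.12 (l.2318–2323):
"h¹(γ) = |E_γ| − |E_γ ∩ E_T|, where T is a spanning tree of G, such that T ∩ γ is a maximal forest, i.e. intersects every connected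
component of γ in a spanning tree." [Borinsky2020] Definition 1 (truncation `p_F`, tropical.tex l.302–306) and the proof of Theorem 32
(l.1217–1219) as quoted in the companions. [Oxley2011] J. Oxley, *Matroid Theory* (2nd ed., OUP 2011), §3.1 (the contraction; for a
graph `M(G/T) = M(G)/T`, Prop. 3.2.1 ff. — cited for the DICTIONARY only; no statement of the book is typed here beyond what Mathlib's
`Matroid.contract` provides).

TYPING (no new definition — D-0026). `E : Fin N → Fin (V+1) × Fin (V+1)`, `Ψ_E = kirchhoffPolynomial ℝ E`, `M = cycleMatroid E` (Mathlib
`Matroid (Fin N)`, ground set `univ`), `γ : Finset (Fin N)` an arbitrary edge set. "T ∩ γ_i connected for all i" ⟺ "T ∩ γ is a maximal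
forest of γ" ⟺ `|T ∩ γ| = rk γ` ⟺ `M.IsBasis ↑(T ∩ γ) ↑γ` (`isBasis_cycleMatroid_iff`); "spanning trees of γ_i" (all i at once) =
bases `F` of `γ` in `M`, the monomial of `Ψ_γ = Π_i Ψ_{γ_i}` being `Π_{e∈γ∖F} X_e`; "spanning trees of G/γ" = bases `T'` of the
CONTRACTION `M ／ ↑γ` (Mathlib `Matroid.contract`), the monomial of `Ψ_{G/γ}` being `Π_{e∈(E∖γ)∖T'} X_e` — this is the one place where
the print's quotient GRAPH is replaced by its matroid (the tree has no quotient edge lists; `M(G/γ) = M(G)/γ` is Oxley's dictionary,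
not typed); the lowest-order part "ψ_{G|γ} = ψ_γ ψ_{G/γ}" of `Ψ_E` in the `γ`-variables is Borinsky's truncation `trunc Ψ_E (−1_γ)` to
the face of `NP_{Ψ_E}` exposed by `y = −1_γ` (Definition 1; `TropicalApproximation.trunc`, `faceValue`, `pairing`), with `setIndicator`
of `LovaszExtension.lean`; "deg_γ" of a monomial `X^d` is `Σ_{e∈γ} d_e`.

PROVED (0 named facts, 0 definitions; Mathlib + companions only): `isBasis_cycleMatroid_iff` (bases of `γ` = maximal spanning
forests: `F ⊆ γ`, `rk F = |F| = rk γ`), `exists_isBasis_cycleMatroid`, **`contract_isBase_iff_of_isBasis`** (LEMMA 2.1's matroid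
core: for a basis `F` of `γ` and `T' ⊆ E∖γ`, `T'` is a base of `M/γ` iff `T' ∪ F` is a base of `M` — via Mathlib's
`Matroid.IsBasis.contract_indep_iff` and maximality), `isBase_union_iff_of_isBasis` (independence of the basis chosen),
`pairing_neg_setIndicator_cotree` (`⟨−1_γ, 1_{E∖T}⟩ = −|γ∖T|`), **`faceValue_kirchhoffPolynomial_neg_setIndicator`** (`max = −ℓ(γ)`:
"deg_γ(ψ_{G|γ}) = h¹_γ", from the companion's `NP_Ψ = 𝒢_ℓ` and `LovaszExtension.lovaszExt_setIndicator`),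
`loopNumber_le_card_sdiff_of_isSpanningTree` (`|γ∖T| ≥ ℓ(γ)`, `=` iff `|T∩γ| = rk γ`), `coeff_trunc`,
**`trunc_kirchhoffPolynomial_neg_setIndicator`** (PROPOSITION 2.2 for `Ψ`, exact form: `Ψ_E|_{F_{−1_γ}} = (Σ_{F basis of γ} Π_{γ∖F} X)
· (Σ_{T' base of M/γ} Π_{(E∖γ)∖T'} X)` for connected `E` — Lemma 2.1's bijection `T ↦ (T ∩ γ, T ∖ γ)` carried out with
`Finset.sum_nbij'`), **`card_sdiff_of_mem_support_kirchhoffPolynomial`** (every monomial of `Ψ_E` has `γ`-degree `≥ ℓ(γ)`, with equality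
iff it lies on the face) and **`remainder_gamma_degree`** ("deg_γ R^Ψ_{γ,G} > h_γ": every monomial of `Ψ_E − Ψ_E|_{F_{−1_γ}}` has
`γ`-degree `≥ ℓ(γ) + 1`).

NOT typed / does NOT say: the `Φ`-laws (Prop. 2.2's second line, Prop. 2.4 IR factorisation, Thm 2.7; Schultka (3)–(5)) — no second
Symanzik polynomial in this lane; Schultka's (2) as an iff about `R^ψ = 0` (only the monomial-wise degree statement is typed, from
which (2) is immediate but not spelled out); the quotient GRAPH `G/γ` and `M(G/γ) = M(G)/γ`; `k`-trees for `k ≥ 2`; anything about the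
forest formula, the K-operation as an operator, signed sums, words, or variance — this is the polynomial identity those constructions
start from, nothing more. (Filed by the pub-qed TROPICAL literature seat `pub-qed-trop-lit` gen 29; `tropical/lit/SOURCES.md` A33.)
-/

noncomputable section

namespace Literature.MathematicalPhysics.QuantumFieldTheory

open Finset MvPolynomial Matroid
open Literature.MathematicalPhysics.QuantumFieldTheory.Borinsky2020

variable {N V : ℕ} (E : Fin N → Fin (V + 1) × Fin (V + 1))

/-! ## The cycle matroid restricted to `γ` and contracted by `γ`: maximal spanning forests of `γ` and spanning trees of `G/γ` -/

/-- **Maximal spanning forests of `γ`** are the bases of `γ` in the cycle matroid: `F ⊆ γ` independent (`rk F = |F|`) with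
`|F| = rk γ` ("T ∩ γ is a maximal forest, i.e. intersects every connected component of γ in a spanning tree").
[cite: Schultka2018, §4 after Corollary 4.12 (toricfeynman.tex l.2318–2323); Oxley2011, §1.3 (bases of a restriction)] -/
theorem isBasis_cycleMatroid_iff (F γ : Finset (Fin N)) :
    (cycleMatroid E).IsBasis (F : Set (Fin N)) (γ : Set (Fin N)) ↔
      F ⊆ γ ∧ edgeRank E F = F.card ∧ F.card = edgeRank E γ := by
  rw [isBasis_iff_indep_encard_eq_of_finite F.finite_toSet (by simp), indep_cycleMatroid_iff_edgeRank,
    eRk_cycleMatroid_eq_edgeRank, Set.encard_coe_eq_coe_finsetCard, Finset.coe_subset, Nat.cast_inj]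

/-- Every edge set has a maximal spanning forest (a basis in the cycle matroid). [cite: Oxley2011, §1.3 (every set has a basis)] -/
theorem exists_isBasis_cycleMatroid (γ : Finset (Fin N)) :
    ∃ F : Finset (Fin N), (cycleMatroid E).IsBasis (F : Set (Fin N)) (γ : Set (Fin N)) := by
  obtain ⟨I, hI⟩ := (cycleMatroid E).exists_isBasis (γ : Set (Fin N)) (by simp)
  obtain ⟨F, rfl⟩ : ∃ F : Finset (Fin N), (F : Set (Fin N)) = I :=
    ⟨(Set.toFinite I).toFinset, by simp⟩
  exact ⟨F, hI⟩

/-- **Spanning trees of the quotient `G/γ` = bases of the contraction `M(G)/γ`**, read against a maximal spanning forest `F` of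
`γ`: for `T' ⊆ E∖γ`, `T'` is a base of `M(G)/γ` iff `T' ∪ F` is a base of `M(G)` (a spanning tree when `G` is connected) — the
pairs `(F, T')` are exactly the spanning trees `T = F ∪ T'` of `G` that meet `γ` in a maximal forest (Schultka's `𝒯¹_γ`;
Brown's Lemma 2.1). [cite: Schultka2018, Proposition 4.11 proof sketch (toricfeynman.tex l.2283–2296); Oxley2011, §3.1 Prop. 3.1.7 (bases of a contraction)] -/
theorem contract_isBase_iff_of_isBasis {F γ T' : Finset (Fin N)}
    (hF : (cycleMatroid E).IsBasis (F : Set (Fin N)) (γ : Set (Fin N))) (hT' : Disjoint T' γ) :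
    ((cycleMatroid E) ／ (γ : Set (Fin N))).IsBase (T' : Set (Fin N)) ↔
      (cycleMatroid E).IsBase ((T' ∪ F : Finset (Fin N)) : Set (Fin N)) := by
  have hdisj : Disjoint (γ : Set (Fin N)) (T' : Set (Fin N)) := by
    rw [Finset.disjoint_coe]; exact hT'.symm
  rw [Finset.coe_union]
  constructor
  · intro hB
    have hind : (cycleMatroid E).Indep ((T' : Set (Fin N)) ∪ F) := ((hF.contract_indep_iff).1 hB.indep).1
    refine hind.isBase_of_forall_insert fun e he => ?_
    have heTF : e ∉ ((T' : Set (Fin N)) ∪ F) := he.2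
    by_cases heγ : e ∈ (γ : Set (Fin N))
    · -- `e ∈ γ ∖ F`: already `F + e` is dependent
      have hdep : (cycleMatroid E).Dep (insert e (F : Set (Fin N))) :=
        hF.insert_dep ⟨heγ, fun h => heTF (Or.inr h)⟩
      exact (hdep.superset (Set.insert_subset_insert Set.subset_union_right) (by simp)).not_indep
    · -- `e ∉ γ`: `T' + e` is dependent in the contraction
      have he' : e ∈ ((cycleMatroid E) ／ (γ : Set (Fin N))).E \ (T' : Set (Fin N)) :=
        ⟨by simp [heγ], fun h => heTF (Or.inl h)⟩
      intro hins
      apply (hB.insert_dep he').not_indep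
      rw [hF.contract_indep_iff, Set.insert_union]
      exact ⟨hins, Set.disjoint_insert_right.2 ⟨heγ, hdisj⟩⟩
  · intro hB
    have hind : ((cycleMatroid E) ／ (γ : Set (Fin N))).Indep (T' : Set (Fin N)) :=
      (hF.contract_indep_iff).2 ⟨hB.indep, hdisj⟩
    refine hind.isBase_of_forall_insert fun e he => ?_
    rw [contract_ground, cycleMatroid_ground] at he
    intro hins
    have h1 := ((hF.contract_indep_iff).1 hins).1
    rw [Set.insert_union] at h1
    have he' : e ∈ (cycleMatroid E).E \ ((T' : Set (Fin N)) ∪ F) := by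
      refine ⟨by simp, ?_⟩
      rintro (h | h)
      · exact he.2 h
      · exact he.1.2 (hF.subset h)
    exact (hB.insert_dep he').not_indep h1

/-- The spanning trees of `G/γ` do not depend on the maximal forest of `γ` used to read them: for two bases `F₀`, `F₁` of `γ`
and `T' ⊆ E∖γ`, `T' ∪ F₀` is a base iff `T' ∪ F₁` is. [cite: Schultka2018, Proposition 4.11 proof sketch (toricfeynman.tex l.2283–2296); Oxley2011, §3.1 Prop. 3.1.7] -/
theorem isBase_union_iff_of_isBasis {F₀ F₁ γ T' : Finset (Fin N)}
    (hF₀ : (cycleMatroid E).IsBasis (F₀ : Set (Fin N)) (γ : Set (Fin N)))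
    (hF₁ : (cycleMatroid E).IsBasis (F₁ : Set (Fin N)) (γ : Set (Fin N))) (hT' : Disjoint T' γ) :
    (cycleMatroid E).IsBase ((T' ∪ F₀ : Finset (Fin N)) : Set (Fin N)) ↔
      (cycleMatroid E).IsBase ((T' ∪ F₁ : Finset (Fin N)) : Set (Fin N)) := by
  rw [← contract_isBase_iff_of_isBasis E hF₀ hT', contract_isBase_iff_of_isBasis E hF₁ hT']

/-! ## The `γ`-degree of `Ψ_E` and its lowest-order part in the `γ`-variables -/

/-- The co-tree exponent vector read in `ℝⁿ` is the indicator `1_{E∖T}`. Plumbing. [folklore] -/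
private theorem natCast_cotree_apply (T : Finset (Fin N)) (k : Fin N) :
    (((∑ e' ∈ Tᶜ, Finsupp.single e' (1 : ℕ) : Fin N →₀ ℕ) k : ℕ) : ℝ) = setIndicator Tᶜ k := by
  rw [Finsupp.coe_finsetSum, Finset.sum_apply]
  simp [Finsupp.single_apply, eq_comm, setIndicator]

/-- The support of the co-tree exponent vector is the co-tree. Plumbing. [folklore] -/
private theorem support_cotree (T : Finset (Fin N)) :
    (∑ e' ∈ Tᶜ, Finsupp.single e' (1 : ℕ) : Fin N →₀ ℕ).support = Tᶜ := by
  ext k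
  rw [Finsupp.mem_support_iff, Finsupp.coe_finsetSum, Finset.sum_apply]
  simp [Finsupp.single_apply, eq_comm]

/-- **The `γ`-degree of a co-tree monomial**: `⟨−1_γ, 1_{E∖T}⟩ = −|γ ∖ T|` (minus the number of `γ`-variables in
`Π_{e∉T} x_e`). [cite: Schultka2018, Proposition 4.11 proof sketch ("The corresponding monomial α^S for S = E_G ∖ T is then minimal in the variables (α_e)_{e∈γ}", toricfeynman.tex l.2288–2289)] -/
theorem pairing_neg_setIndicator_cotree (γ T : Finset (Fin N)) :
    pairing (-setIndicator γ) (∑ e' ∈ Tᶜ, Finsupp.single e' (1 : ℕ)) = -((γ \ T).card : ℝ) := by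
  unfold pairing
  rw [support_cotree]
  have h1 : ∀ i ∈ Tᶜ, (-setIndicator γ) i * (((∑ e' ∈ Tᶜ, Finsupp.single e' (1 : ℕ) : Fin N →₀ ℕ) i : ℕ) : ℝ) =
      -(if i ∈ γ then (1 : ℝ) else 0) := by
    intro i hi
    rw [natCast_cotree_apply, Pi.neg_apply]
    simp [setIndicator, Finset.mem_compl.1 hi]
  rw [Finset.sum_congr rfl h1, Finset.sum_neg_distrib, Finset.sum_boole, neg_inj, Nat.cast_inj]
  congr 1
  ext e
  simp [Finset.mem_sdiff, and_comm]

/-- **`deg_γ Ψ_G`'s lowest value is the loop number**: the face value of `NP_{Ψ_E}` in direction `−1_γ` is `−ℓ(γ)`, i.e. the least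
number of `γ`-variables in a monomial of `Ψ_E` is `h¹(γ)` ("deg_γ(ψ_{G|γ}) = h¹_γ"; Brown: the degree of the rest term in the
variables α_e, e ∈ E_γ, is strictly greater than `deg Ψ_γ = h_γ`). [cite: Schultka2018, Proposition 4.11 (1) (toricfeynman.tex l.2236–2255); Brown2017, Prop. 2.2 (arXiv:1512.06409v3 PDF p.16); Borinsky2020, Theorem 32 (z_Ψ(γ) = ℓ(γ))] -/
theorem faceValue_kirchhoffPolynomial_neg_setIndicator (hconn : IsConnectedEdgeList E) (γ : Finset (Fin N)) :
    faceValue (kirchhoffPolynomial ℝ E) (-setIndicator γ) = -(loopNumber E γ : ℝ) := by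
  rw [faceValue_kirchhoffPolynomial_eq_gpSupport E hconn]
  have h := lovaszExt_setIndicator (fun A : Finset (Fin N) => -(loopNumber E A : ℝ)) γ
  simp only [lovaszExt, neg_neg, loopNumber_empty, Nat.cast_zero, neg_zero, sub_zero] at h
  exact h

/-- For a spanning tree `T`, `|γ ∖ T| ≥ ℓ(γ)` (`T ∩ γ` is a forest of `γ`), with equality iff `T ∩ γ` is a maximal spanning forest of
`γ` (`|T ∩ γ| = rk γ`). [cite: Schultka2018, §4 after Corollary 4.12 (toricfeynman.tex l.2318–2323); Panzer2022, §2.3 (proof of Lemma 2.16)] -/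
theorem loopNumber_le_card_sdiff_of_isSpanningTree {T : Finset (Fin N)} (hT : IsSpanningTree E T)
    (γ : Finset (Fin N)) :
    loopNumber E γ ≤ (γ \ T).card ∧ ((γ \ T).card = loopNumber E γ ↔ (T ∩ γ).card = edgeRank E γ) := by
  have h1 := hT.card_inter_le_edgeRank γ
  have h2 : (γ \ T).card + (T ∩ γ).card = γ.card := by
    rw [Finset.inter_comm]; exact Finset.card_sdiff_add_card_inter γ T
  have h3 := edgeRank_le_card E γ
  unfold loopNumber
  omega

/-! ## The factorisation `Ψ_G|_{face −1_γ} = Ψ_γ · Ψ_{G/γ}` -/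

open scoped Classical in
/-- **Brown's factorisation of the first Symanzik polynomial, in matroid form (Brown 2017 Prop. 2.2 / Schultka 2018 Prop. 4.11:
"ψ_G = ψ_γ ψ_{G/γ} + R^ψ_{G|γ}" with "deg_γ(R^ψ_{G|γ}) > deg_γ(ψ_{G|γ}) = h¹_γ")** — the lowest-order part of `Ψ_E` in the
`γ`-variables, i.e. Borinsky's truncation `Ψ_{E,F}` to the face `F` of `NP_{Ψ_E}` exposed by `y = −1_γ`, FACTORISES:
`Ψ_E|_{F_{−1_γ}} = (Σ_{F maximal spanning forest of γ} Π_{e∈γ∖F} X_e) · (Σ_{T' spanning tree of G/γ} Π_{e∈(E∖γ)∖T'} X_e)`, where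
"maximal spanning forest of γ" = basis of `γ` in the cycle matroid (so the first factor is `Π_i Ψ_{γ_i}` over the components) and
"spanning tree of G/γ" = base of the contraction `M(E)/γ` (Oxley: `M(G/T) = M(G)/T`). Proof = the printed one: the monomials of
`Ψ_E` on the face are the co-trees of the spanning trees `T` with `|T ∩ γ|` maximal (`= rk γ`), and `T ↦ (T ∩ γ, T ∖ γ)` is a
bijection onto (bases of γ) × (bases of M/γ) (`contract_isBase_iff_of_isBasis`). [cite: Schultka2018, Proposition 4.11 (1)–(2) and proof sketch (toricfeynman.tex l.2236–2296); Brown2017, Prop. 2.2 and Lemma 2.1 (arXiv:1512.06409v3 PDF p.15–16); Borinsky2020, Definition 1 (truncation p_F, tropical.tex l.302–306) and proof of Theorem 32 ("follows directly from the factorization laws", l.1217–1219); Oxley2011, §3.1 Prop. 3.1.7 / eq. (3.1.2)] -/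
theorem trunc_kirchhoffPolynomial_neg_setIndicator (hconn : IsConnectedEdgeList E) (γ : Finset (Fin N)) :
    trunc (kirchhoffPolynomial ℝ E) (-setIndicator γ) =
      (∑ F ∈ γ.powerset.filter
          (fun F : Finset (Fin N) => (cycleMatroid E).IsBasis (↑F : Set (Fin N)) (↑γ : Set (Fin N))),
          ∏ e ∈ γ \ F, (X e : MvPolynomial (Fin N) ℝ)) *
      (∑ T' ∈ γᶜ.powerset.filter
          (fun T' : Finset (Fin N) => ((cycleMatroid E) ／ (↑γ : Set (Fin N))).IsBase (↑T' : Set (Fin N))),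
          ∏ e ∈ γᶜ \ T', (X e : MvPolynomial (Fin N) ℝ)) := by
  -- the face: spanning trees meeting `γ` in a maximal forest
  set face : Finset (Finset (Fin N)) :=
    univ.filter (fun T => IsSpanningTree E T ∧ (T ∩ γ).card = edgeRank E γ) with hface
  have hLHS : trunc (kirchhoffPolynomial ℝ E) (-setIndicator γ) =
      ∑ T ∈ face, ∏ e ∈ Tᶜ, (X e : MvPolynomial (Fin N) ℝ) := by
    unfold trunc
    rw [support_kirchhoffPolynomial E ℝ, Finset.filter_image, Finset.sum_image]
    · rw [faceValue_kirchhoffPolynomial_neg_setIndicator E hconn]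
      have hfilter : (univ.filter (IsSpanningTree E)).filter
          (fun T => pairing (-setIndicator γ) (∑ e' ∈ Tᶜ, Finsupp.single e' (1 : ℕ)) = -(loopNumber E γ : ℝ)) = face := by
        ext T
        simp only [hface, Finset.mem_filter, Finset.mem_univ, true_and, pairing_neg_setIndicator_cotree, neg_inj,
          Nat.cast_inj]
        constructor
        · rintro ⟨hT, h⟩; exact ⟨hT, ((loopNumber_le_card_sdiff_of_isSpanningTree E hT γ).2).1 h⟩
        · rintro ⟨hT, h⟩; exact ⟨hT, ((loopNumber_le_card_sdiff_of_isSpanningTree E hT γ).2).2 h⟩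
      rw [hfilter]
      refine Finset.sum_congr rfl fun T hT => ?_
      have hT' : IsSpanningTree E T := ((Finset.mem_filter.1 hT).2).1
      rw [coeff_kirchhoffPolynomial_of_mem_support E ℝ (sum_single_compl_mem_support E hT'), kirchhoffMonomial_eq]
    · intro T₁ hT₁ T₂ hT₂ h
      have := congrArg Finsupp.support h
      rwa [support_cotree, support_cotree, compl_inj_iff] at this
  -- the right-hand side as a sum over pairs
  obtain ⟨F₀, hF₀⟩ := exists_isBasis_cycleMatroid E γ
  rw [hLHS, Finset.sum_mul_sum, ← Finset.sum_product']
  symm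
  refine Finset.sum_nbij' (fun p : Finset (Fin N) × Finset (Fin N) => p.1 ∪ p.2)
    (fun T : Finset (Fin N) => (T ∩ γ, T \ γ)) ?_ ?_ ?_ ?_ ?_
  · -- (F, T') ↦ F ∪ T' lands in the face
    rintro ⟨F, T'⟩ hp
    rw [Finset.mem_product] at hp
    obtain ⟨hF, hT'⟩ := hp
    rw [Finset.mem_filter, Finset.mem_powerset] at hF hT'
    have hdisj : Disjoint T' γ := Finset.disjoint_left.2 fun e he heγ => (Finset.mem_compl.1 (hT'.1 he)) heγ
    have hbase : (cycleMatroid E).IsBase ((T' ∪ F : Finset (Fin N)) : Set (Fin N)) :=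
      (contract_isBase_iff_of_isBasis E hF.2 hdisj).1 hT'.2
    have hFγ := (isBasis_cycleMatroid_iff E F γ).1 hF.2
    simp only [hface, Finset.mem_filter, Finset.mem_univ, true_and]
    refine ⟨?_, ?_⟩
    · rw [Finset.union_comm]; exact (isBase_cycleMatroid_iff_isSpanningTree E hconn _).1 hbase
    · rw [Finset.union_inter_distrib_right, Finset.inter_eq_left.2 hFγ.1, Finset.disjoint_iff_inter_eq_empty.1 hdisj,
        Finset.union_empty, hFγ.2.2]
  · -- T ↦ (T ∩ γ, T ∖ γ) lands in (bases of γ) × (bases of M/γ)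
    intro T hT
    simp only [hface, Finset.mem_filter, Finset.mem_univ, true_and] at hT
    obtain ⟨hT, hcard⟩ := hT
    have hbase : (cycleMatroid E).IsBase (T : Set (Fin N)) := (isBase_cycleMatroid_iff_isSpanningTree E hconn T).2 hT
    have hind : (cycleMatroid E).Indep ((T ∩ γ : Finset (Fin N)) : Set (Fin N)) :=
      hbase.indep.subset (by rw [Finset.coe_inter]; exact Set.inter_subset_left)
    have hbasis : (cycleMatroid E).IsBasis ((T ∩ γ : Finset (Fin N)) : Set (Fin N)) (γ : Set (Fin N)) := by
      rw [isBasis_cycleMatroid_iff]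
      exact ⟨Finset.inter_subset_right, (indep_cycleMatroid_iff_edgeRank E _).1 hind, hcard⟩
    have hdisj : Disjoint (T \ γ) γ := Finset.sdiff_disjoint
    rw [Finset.mem_product, Finset.mem_filter, Finset.mem_powerset, Finset.mem_filter, Finset.mem_powerset]
    refine ⟨⟨Finset.inter_subset_right, hbasis⟩, fun e he => Finset.mem_compl.2 (Finset.mem_sdiff.1 he).2, ?_⟩
    rw [contract_isBase_iff_of_isBasis E hbasis hdisj, Finset.sdiff_union_inter]
    exact hbase
  · -- left inverse
    rintro ⟨F, T'⟩ hp
    rw [Finset.mem_product] at hp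
    obtain ⟨hF, hT'⟩ := hp
    rw [Finset.mem_filter, Finset.mem_powerset] at hF hT'
    have hdisj : Disjoint T' γ := Finset.disjoint_left.2 fun e he heγ => (Finset.mem_compl.1 (hT'.1 he)) heγ
    ext1
    · show (F ∪ T') ∩ γ = F
      rw [Finset.union_inter_distrib_right, Finset.inter_eq_left.2 hF.1, Finset.disjoint_iff_inter_eq_empty.1 hdisj,
        Finset.union_empty]
    · show (F ∪ T') \ γ = T'
      rw [Finset.union_sdiff_distrib, Finset.sdiff_eq_empty_iff_subset.2 hF.1, Finset.empty_union]
      exact sdiff_eq_left.2 hdisj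
  · -- right inverse
    intro T _
    show T ∩ γ ∪ T \ γ = T
    rw [Finset.union_comm, Finset.sdiff_union_inter]
  · -- the monomials agree: `Π_{(F∪T')ᶜ} X = Π_{γ∖F} X · Π_{γᶜ∖T'} X`
    rintro ⟨F, T'⟩ hp
    rw [Finset.mem_product] at hp
    obtain ⟨hF, hT'⟩ := hp
    rw [Finset.mem_filter, Finset.mem_powerset] at hF hT'
    have hsplit : (F ∪ T')ᶜ = (γ \ F) ∪ (γᶜ \ T') := by
      ext e
      simp only [Finset.mem_compl, Finset.mem_union, Finset.mem_sdiff, not_or]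
      constructor
      · rintro ⟨heF, heT'⟩
        by_cases heγ : e ∈ γ
        · exact Or.inl ⟨heγ, heF⟩
        · exact Or.inr ⟨heγ, heT'⟩
      · rintro (⟨heγ, heF⟩ | ⟨heγ, heT'⟩)
        · exact ⟨heF, fun h => (Finset.mem_compl.1 (hT'.1 h)) heγ⟩
        · exact ⟨fun h => heγ (hF.1 h), heT'⟩
    have hdisj : Disjoint (γ \ F) (γᶜ \ T') :=
      Finset.disjoint_left.2 fun e he he' => (Finset.mem_compl.1 (Finset.mem_sdiff.1 he').1) (Finset.mem_sdiff.1 he).1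
    show (∏ e ∈ γ \ F, X e) * ∏ e ∈ γᶜ \ T', X e = ∏ e ∈ (F ∪ T')ᶜ, (X e : MvPolynomial (Fin N) ℝ)
    rw [hsplit, Finset.prod_union hdisj]
  where
  /-- the monomial with exponent `1_{E∖T}` and coefficient `1` is `Π_{e∉T} X_e` -/
  kirchhoffMonomial_eq {T : Finset (Fin N)} :
      (monomial (∑ e' ∈ Tᶜ, Finsupp.single e' (1 : ℕ)) (1 : ℝ) : MvPolynomial (Fin N) ℝ) = ∏ e ∈ Tᶜ, X e := by
    induction Tᶜ using Finset.induction_on with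
    | empty => simp
    | insert e S he ih =>
      rw [Finset.sum_insert he, Finset.prod_insert he, ← ih, ← pow_one (X e), X_pow_eq_monomial, monomial_mul, one_mul]

open scoped Classical in
/-- The coefficients of Borinsky's truncation `p_F` (Definition 1): `c_ℓ` on the face `F = F_y`, `0` off it. Plumbing.
[cite: Borinsky2020, Definition 1 (tropical.tex l.302–306)] -/
theorem coeff_trunc (p : MvPolynomial (Fin N) ℝ) (y : Fin N → ℝ) (d : Fin N →₀ ℕ) :
    coeff d (trunc p y) = if d ∈ p.support ∧ pairing y d = faceValue p y then coeff d p else 0 := by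
  unfold trunc
  rw [coeff_sum]
  simp only [coeff_monomial]
  by_cases h : d ∈ p.support.filter (fun d => pairing y d = faceValue p y)
  · rw [Finset.sum_eq_single_of_mem d h (fun b _ hbd => if_neg hbd), if_pos rfl, if_pos (Finset.mem_filter.1 h)]
  · rw [Finset.sum_eq_zero (fun b hb => by rw [if_neg]; rintro rfl; exact h hb),
      if_neg (fun h' => h (Finset.mem_filter.2 h'))]

open scoped Classical in
/-- **Every monomial of the lowest-order part has exactly `ℓ(γ)` `γ`-variables, every other monomial of `Ψ_E` strictly more**
("deg_γ(R^ψ_{G|γ}) > deg_γ(ψ_{G|γ}) = h¹_γ"): the `γ`-degree `|γ ∖ T|` of the co-tree monomial of a spanning tree `T` is `≥ ℓ(γ)`,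
with equality exactly on the face `F_{−1_γ}`. [cite: Schultka2018, Proposition 4.11 (1) (toricfeynman.tex l.2246–2255); Brown2017, Prop. 2.2] -/
theorem card_sdiff_of_mem_support_kirchhoffPolynomial {d : Fin N →₀ ℕ} (hd : d ∈ (kirchhoffPolynomial ℝ E).support)
    (γ : Finset (Fin N)) :
    (loopNumber E γ : ℝ) ≤ ∑ e ∈ γ, (d e : ℝ) ∧
      ((∑ e ∈ γ, (d e : ℝ)) = loopNumber E γ ↔
        d ∈ (trunc (kirchhoffPolynomial ℝ E) (-setIndicator γ)).support) := by
  obtain ⟨T, hT, rfl⟩ := exists_isSpanningTree_of_mem_support E hd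
  have hconn : IsConnectedEdgeList E := hT.isConnectedEdgeList
  have hsum : ∑ e ∈ γ, (((∑ e' ∈ Tᶜ, Finsupp.single e' (1 : ℕ) : Fin N →₀ ℕ) e : ℕ) : ℝ) = ((γ \ T).card : ℝ) := by
    simp only [natCast_cotree_apply, setIndicator, Finset.mem_compl]
    rw [Finset.sum_boole]
    congr 2
    ext e
    simp [Finset.mem_sdiff]
  have hle := loopNumber_le_card_sdiff_of_isSpanningTree E hT γ
  rw [hsum]
  refine ⟨by exact_mod_cast hle.1, ?_⟩
  rw [Nat.cast_inj, MvPolynomial.mem_support_iff, coeff_trunc, faceValue_kirchhoffPolynomial_neg_setIndicator E hconn,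
    pairing_neg_setIndicator_cotree, coeff_kirchhoffPolynomial_of_mem_support E ℝ (sum_single_compl_mem_support E hT)]
  constructor
  · intro h
    rw [if_pos ⟨sum_single_compl_mem_support E hT, by rw [h]⟩]
    exact one_ne_zero
  · intro h
    by_contra hne
    refine h (if_neg ?_)
    rintro ⟨_, h2⟩
    exact hne (by exact_mod_cast neg_inj.1 h2)

open scoped Classical in
/-- **"ψ_G = ψ_γ ψ_{G/γ} + R^ψ_{G|γ}" with "deg_γ(R^ψ_{G|γ}) > deg_γ(ψ_{G|γ}) = h¹_γ"** — the remainder form as printed: every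
monomial of `R = Ψ_E − Ψ_E|_{F_{−1_γ}}` (the co-trees off the face) carries at least `ℓ(γ) + 1` variables of `γ`.
[cite: Brown2017, Prop. 2.2 eq. (2.2) (arXiv:1512.06409v3 PDF p.16); Schultka2018, Proposition 4.11 (1) (toricfeynman.tex l.2236–2255)] -/
theorem remainder_gamma_degree (γ : Finset (Fin N)) {d : Fin N →₀ ℕ}
    (hd : d ∈ (kirchhoffPolynomial ℝ E - trunc (kirchhoffPolynomial ℝ E) (-setIndicator γ)).support) :
    (loopNumber E γ : ℝ) + 1 ≤ ∑ e ∈ γ, (d e : ℝ) := by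
  rw [MvPolynomial.mem_support_iff, coeff_sub, sub_ne_zero] at hd
  by_cases hc : d ∈ (kirchhoffPolynomial ℝ E).support ∧
      pairing (-setIndicator γ) d = faceValue (kirchhoffPolynomial ℝ E) (-setIndicator γ)
  · exact absurd (by rw [coeff_trunc, if_pos hc]) hd
  · have hdΨ : d ∈ (kirchhoffPolynomial ℝ E).support := by
      rw [MvPolynomial.mem_support_iff]
      intro h0
      apply hd
      rw [h0, coeff_trunc, if_neg hc]
    obtain ⟨h1, h2⟩ := card_sdiff_of_mem_support_kirchhoffPolynomial E hdΨ γ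
    have hne : (∑ e ∈ γ, (d e : ℝ)) ≠ loopNumber E γ := fun h => by
      have hmem := h2.1 h
      rw [MvPolynomial.mem_support_iff, coeff_trunc, if_neg hc] at hmem
      exact hmem rfl
    have hnat : (∑ e ∈ γ, (d e : ℝ)) = ((∑ e ∈ γ, d e : ℕ) : ℝ) := by push_cast; rfl
    rw [hnat] at h1 hne ⊢
    have hlt : loopNumber E γ < ∑ e ∈ γ, d e :=
      lt_of_le_of_ne (by exact_mod_cast h1) (fun h => hne (by rw [h]))
    exact_mod_cast Nat.succ_le_of_lt hlt

end Literature.MathematicalPhysics.QuantumFieldTheory
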